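import Mathlib.Topology.MetricSpace.Contracting
import Mathlib.Analysis.Normed.Operator.Banach
import HarnessLib

/-!
# Unique zeros of Lipschitz-small perturbations of linear isomorphisms (quantitative inverse function theorem)

Analysis/Calculus support file (everything proved).  The EXISTENCE-and-uniqueness half of the finite-dimensional
parameter-selection step of matched gluing constructions (Corvino–Schoen 2006, §5), without degree theory: if the
balance map at radius `R` has the form `θ ↦ L (θ − θ₀) + N θ` with `L` a linear isomorphism (the charge Jacobian of
the Kerr family) and a remainder `N` which is Lipschitz-small on a closed ball and small at its centre, then it has a
UNIQUE zero in that ball (Banach's fixed point theorem for `θ ↦ θ₀ − L⁻¹ N θ`).  Together with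
`ImplicitZeroCurve.lean` (unique non-degenerate zeros in a compact set form a smooth curve) this replaces the degree
argument whenever the remainder is `C¹`-small.

* `exists_unique_zero_of_lipschitzOnWith` — existence and uniqueness of the zero in `closedBall θ₀ r`.

## References

* J. Corvino, R. Schoen, *On the asymptotics for the vacuum Einstein constraint equations*, J. Differential Geom.
  73 (2006) 185–217, §5. [`CorvinoSchoen2006`]
* J. Dieudonné, *Foundations of Modern Analysis* (1969), (10.1.1)–(10.2.1) (fixed points and implicit functions).
-/

noncomputable section

namespace Literature.Analysis.Calculus

open scoped Topology NNReal
open Set Filter Function Metric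

variable {E : Type*} [NormedAddCommGroup E] [NormedSpace ℝ E] [CompleteSpace E]
  {F : Type*} [NormedAddCommGroup F] [NormedSpace ℝ F]

/-- **Unique zero of a Lipschitz-small perturbation of a linear isomorphism.**  Let `L : E ≃L F`, `θ₀ ∈ E`,
`r ≥ 0`, and `N : E → F` be Lipschitz on `closedBall θ₀ r` with constant `K`, where `K ‖L⁻¹‖ ≤ 1/2` and
`‖L⁻¹ (N θ₀)‖ ≤ r/2`.  Then `θ ↦ L (θ − θ₀) + N θ` has exactly one zero in `closedBall θ₀ r`: the zeros are the
fixed points of `T θ := θ₀ − L⁻¹ (N θ)`, which maps the (complete) closed ball into itself and is a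
`1/2`-contraction there. [folklore] -/
theorem exists_unique_zero_of_lipschitzOnWith (L : E ≃L[ℝ] F) (N : E → F) (θ₀ : E) {r : ℝ} (hr : 0 ≤ r)
    {K : ℝ≥0} (hN : LipschitzOnWith K N (closedBall θ₀ r))
    (hK : (K : ℝ) * ‖(L.symm : F →L[ℝ] E)‖ ≤ 1 / 2) (h0 : ‖L.symm (N θ₀)‖ ≤ r / 2) :
    ∃! θ : E, θ ∈ closedBall θ₀ r ∧ L (θ - θ₀) + N θ = 0 := by
  set T : E → E := fun θ ↦ θ₀ - L.symm (N θ) with hT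
  -- zeros are fixed points of `T`
  have hzero : ∀ θ : E, L (θ - θ₀) + N θ = 0 ↔ T θ = θ := by
    intro θ
    constructor
    · intro h
      have h1 : L.symm (L (θ - θ₀) + N θ) = 0 := by rw [h, map_zero]
      rw [map_add, L.symm_apply_apply] at h1
      have h2 : L.symm (N θ) = -(θ - θ₀) := eq_neg_of_add_eq_zero_right h1
      show θ₀ - L.symm (N θ) = θ
      rw [h2]; abel
    · intro h
      have h' : θ₀ - L.symm (N θ) = θ := h
      have h1 : θ - θ₀ = -L.symm (N θ) := by
        nth_rewrite 1 [← h']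
        abel
      rw [h1, map_neg, L.apply_symm_apply, neg_add_cancel]
  -- `T` is `K ‖L⁻¹‖`-Lipschitz on the ball
  have hlip : ∀ θ ∈ closedBall θ₀ r, ∀ θ' ∈ closedBall θ₀ r, dist (T θ) (T θ') ≤ (1 / 2) * dist θ θ' := by
    intro θ hθ θ' hθ'
    have h1 : dist (T θ) (T θ') = ‖L.symm (N θ') - L.symm (N θ)‖ := by
      simp only [hT, dist_eq_norm]
      congr 1; abel
    rw [h1, ← map_sub]
    calc ‖L.symm (N θ' - N θ)‖ ≤ ‖(L.symm : F →L[ℝ] E)‖ * ‖N θ' - N θ‖ := (L.symm : F →L[ℝ] E).le_opNorm _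
      _ ≤ ‖(L.symm : F →L[ℝ] E)‖ * (K * dist θ θ') := by
          refine mul_le_mul_of_nonneg_left ?_ (norm_nonneg _)
          rw [← dist_eq_norm, dist_comm]; exact hN.dist_le_mul θ hθ θ' hθ'
      _ = (K * ‖(L.symm : F →L[ℝ] E)‖) * dist θ θ' := by ring
      _ ≤ (1 / 2) * dist θ θ' := mul_le_mul_of_nonneg_right hK dist_nonneg
  -- `T` maps the ball into itself
  have hmaps : MapsTo T (closedBall θ₀ r) (closedBall θ₀ r) := by
    intro θ hθ
    rw [mem_closedBall] at hθ ⊢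
    have h1 : dist (T θ) θ₀ ≤ dist (T θ) (T θ₀) + dist (T θ₀) θ₀ := dist_triangle _ _ _
    have h2 : dist (T θ₀) θ₀ = ‖L.symm (N θ₀)‖ := by simp [hT]
    have h3 := hlip θ (mem_closedBall.2 hθ) θ₀ (mem_closedBall_self hr)
    linarith
  -- Banach fixed point on the complete closed ball
  have hcontr : ContractingWith (1 / 2 : ℝ≥0) (hmaps.restrict T (closedBall θ₀ r) (closedBall θ₀ r)) := by
    refine ⟨by norm_num, LipschitzWith.of_dist_le_mul fun θ θ' ↦ ?_⟩
    have h := hlip θ θ.2 θ' θ'.2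
    simpa [Subtype.dist_eq] using h
  obtain ⟨θ, hθmem, hfix, -⟩ := hcontr.exists_fixedPoint' (isClosed_closedBall.isComplete) hmaps
    (mem_closedBall_self hr) (edist_ne_top _ _)
  refine ⟨θ, ⟨hθmem, (hzero θ).2 hfix⟩, fun θ' ⟨hθ'mem, hθ'⟩ ↦ ?_⟩
  -- uniqueness: two fixed points in the ball are at distance `≤ (1/2) ·` their distance
  have hfix' : T θ' = θ' := (hzero θ').1 hθ'
  have h := hlip θ' hθ'mem θ hθmem
  rw [hfix', hfix.eq] at h
  have hd : dist θ' θ = 0 := by linarith [dist_nonneg (x := θ') (y := θ)]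
  exact dist_eq_zero.1 hd
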